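import Summits.QuantumFields.YangMills.Theorems.SwapVirialDeficitBlowUpGnomonicRelationQuaternions
import HarnessLib

/-!
# GROUP DISPLACEMENTS OF THE GNOMONIC LETTERS — the compressed distances of memo11a, for N2a step (iv) of `stub_end_gaussCore`
# (free-hands support of ⟨stmt-QuantumFields-24197⟩ `SwapVirialDeficit.SwapGluedStiffness`; LEAD g99 23:30Z claim)

The follower-determinant matching of the end Gaussian core must be done in the GROUP (w2 g60's K7g law ✓`abs_log_det_gnoFolHessian_sub_le_leaders`), not in the chart:
at the gnomonic ends a transverse letter `u` with `|u| ≍ r·x₀` is chart-far but group-close.  The three displacements that law consumes, each from ONE real inequality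
`A·((√(A+U))⁻¹ − (√A)⁻¹)² + U/(A+U) ≤ 2·U/(A+U)` (§0):
* §1 ★ `norm_sq_radialUnit_gnoLetter_axial_sub_le` : `‖ν(±(1,x)) − ν(±(1,(x₀,0,0)))‖² ≤ 2·(x₁²+x₂²)/(1 + x₀² + (x₁²+x₂²))` (= `2g_u²`, the compressed transverse displacement);
* §2 ★ `norm_sq_radialUnit_gnoLetter_sub_one_le` : `‖ν((1,z)) − 1‖² ≤ 2·|z|²/(1+|z|²)`;
* §3 ★ `norm_sq_radialUnit_hubAt_sub_le` : `‖ν(hubAt δ 1) − ν(hubAt 0 1)‖² ≤ 2·δ²/(1+δ²)` (the hub link of the slab hub against the reference hub).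

HONEST LABEL: elementary algebra; `stub_end_gaussCore` (N2a (iv), NEAR₂, glue, plug), `stub_core_tip`, ⟨24197⟩ ∕ ⟨24194⟩ OPEN; own crux ⟨22884⟩ `LargeFieldMassRefinementTail`
OPEN (blocked-on ⟨19935⟩); the Yang–Mills mass gap is NOT proved; no summit is proved by a line.  THEOREMS ONLY (0 `def`, 0 `sorry`, no instance), standard axioms.
LEAD seat ym-line-sfw-p2 g99 (cell ym-idea-1, free hands), `--supports stmt-QuantumFields-24197`.  References: [folklore].
-/

set_option autoImplicit false
set_option synthInstance.maxSize 1024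

noncomputable section

open Quaternion Set
open scoped Quaternion BigOperators
open Literature.MathematicalPhysics.QuantumLattice
open Literature.MathematicalPhysics.QuantumFieldTheory hiding SU2
open Literature.Analysis.Calculus (radialUnit radialUnit_def norm_radialUnit)

namespace Summit.QuantumFields.YangMills.Theorems.SwapVirialDeficit.BlowUpRing

/-! ## §0 The one real inequality -/

/-- `A·((√(A+U))⁻¹ − (√A)⁻¹)² + U/(A+U) ≤ 2·U/(A+U)` for `A > 0`, `U ≥ 0` (`(√B − √A)² ≤ B − A`). [folklore] -/
theorem axial_displacement_core {A U : ℝ} (hA : 0 < A) (hU : 0 ≤ U) :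
    A * ((Real.sqrt (A + U))⁻¹ - (Real.sqrt A)⁻¹) ^ 2 + U / (A + U) ≤ 2 * (U / (A + U)) := by
  set a : ℝ := Real.sqrt A with ha
  set b : ℝ := Real.sqrt (A + U) with hb
  have ha0 : 0 < a := Real.sqrt_pos.2 hA
  have hB0 : 0 < A + U := by linarith
  have hb0 : 0 < b := Real.sqrt_pos.2 hB0
  have hab : a ≤ b := Real.sqrt_le_sqrt (by linarith)
  have hA2 : a ^ 2 = A := Real.sq_sqrt hA.le
  have hB2 : b ^ 2 = A + U := Real.sq_sqrt hB0.le
  have e : A * (b⁻¹ - a⁻¹) ^ 2 = (b - a) ^ 2 / b ^ 2 := by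
    rw [← hA2]; field_simp; ring
  have key : (b - a) ^ 2 / b ^ 2 ≤ U / (A + U) := by
    rw [← hB2]
    refine div_le_div_of_nonneg_right ?_ (by positivity)
    nlinarith
  rw [e]
  linarith

/-! ## §1 The transverse displacement of a gnomonic letter -/

/-- ★ **THE COMPRESSED TRANSVERSE DISPLACEMENT**: `‖ν(±(1,x)) − ν(±(1,(x₀,0,0)))‖² ≤ 2·(x₁²+x₂²)/(1 + x₀² + (x₁²+x₂²))`. [folklore] -/
theorem norm_sq_radialUnit_gnoLetter_axial_sub_le (ε : Bool) (x : Fin 3 → ℝ) :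
    ‖radialUnit (gnoLetter ε x) - radialUnit (gnoLetter ε ![x 0, 0, 0])‖ ^ 2 ≤ 2 * (((x 1) ^ 2 + (x 2) ^ 2) / (1 + (x 0) ^ 2 + ((x 1) ^ 2 + (x 2) ^ 2))) := by
  obtain ⟨r0, r1, r2, r3⟩ := bfar_gnoLetter_components ε x
  obtain ⟨s0, s1, s2, s3⟩ := bfar_gnoLetter_components ε ![x 0, 0, 0]
  have hs : gnoSign ε ^ 2 = 1 := gnoSign_sq ε
  have hnX : ‖gnoLetter ε x‖ ^ 2 = 1 + ((x 0) ^ 2 + (x 1) ^ 2 + (x 2) ^ 2) := bfar_norm_gnoLetter_sq ε x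
  have hnX0 : ‖gnoLetter ε ![x 0, 0, 0]‖ ^ 2 = 1 + (x 0) ^ 2 := by
    rw [bfar_norm_gnoLetter_sq]; simp
  set A : ℝ := 1 + (x 0) ^ 2 with hA
  set U : ℝ := (x 1) ^ 2 + (x 2) ^ 2 with hU
  have hA0 : 0 < A := by positivity
  have hU0 : 0 ≤ U := by positivity
  have hnX' : ‖gnoLetter ε x‖ = Real.sqrt (A + U) := by
    rw [← Real.sqrt_sq (norm_nonneg (gnoLetter ε x)), hnX]; congr 1; rw [hA, hU]; ring
  have hnX0' : ‖gnoLetter ε ![x 0, 0, 0]‖ = Real.sqrt A := by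
    rw [← Real.sqrt_sq (norm_nonneg (gnoLetter ε ![x 0, 0, 0])), hnX0]
  -- components of the difference of the radial projections
  have hcomp : ‖radialUnit (gnoLetter ε x) - radialUnit (gnoLetter ε ![x 0, 0, 0])‖ ^ 2 =
      gnoSign ε ^ 2 * (((‖gnoLetter ε x‖⁻¹ - ‖gnoLetter ε ![x 0, 0, 0]‖⁻¹) ^ 2) * (1 + (x 0) ^ 2) +
        (‖gnoLetter ε x‖⁻¹) ^ 2 * ((x 1) ^ 2 + (x 2) ^ 2)) := by
    rw [sq_norm_eq_sum_sq, radialUnit_def, radialUnit_def]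
    simp only [Quaternion.re_sub, Quaternion.imI_sub, Quaternion.imJ_sub, Quaternion.imK_sub, Quaternion.re_smul, Quaternion.imI_smul,
      Quaternion.imJ_smul, Quaternion.imK_smul, smul_eq_mul, r0, r1, r2, r3, s0, s1, s2, s3]
    simp only [Matrix.cons_val_zero, Matrix.cons_val_one, Matrix.cons_val_two, Matrix.head_cons, Matrix.tail_cons]
    ring
  rw [hcomp, hs, one_mul, hnX', hnX0', inv_pow, Real.sq_sqrt (by positivity)]
  have h := axial_displacement_core hA0 hU0
  rw [hA, hU] at h
  have e : U / (A + U) = ((x 1) ^ 2 + (x 2) ^ 2) / (1 + (x 0) ^ 2 + ((x 1) ^ 2 + (x 2) ^ 2)) := by rw [hA, hU]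
  calc (((Real.sqrt (A + U))⁻¹ - (Real.sqrt A)⁻¹) ^ 2) * (1 + (x 0) ^ 2) + (A + U)⁻¹ * ((x 1) ^ 2 + (x 2) ^ 2)
      = A * ((Real.sqrt (A + U))⁻¹ - (Real.sqrt A)⁻¹) ^ 2 + U / (A + U) := by rw [hA, hU, div_eq_inv_mul]; ring
    _ ≤ 2 * (U / (A + U)) := axial_displacement_core hA0 hU0
    _ = _ := by rw [hA, hU]

/-! ## §2 The `z`-letter against the identity -/

/-- ★ `‖ν((1,z)) − 1‖² ≤ 2·|z|²/(1+|z|²)`. [folklore] -/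
theorem norm_sq_radialUnit_gnoLetter_sub_one_le (z : Fin 3 → ℝ) :
    ‖radialUnit (gnoLetter true z) - 1‖ ^ 2 ≤ 2 * (((z 0) ^ 2 + (z 1) ^ 2 + (z 2) ^ 2) / (1 + ((z 0) ^ 2 + (z 1) ^ 2 + (z 2) ^ 2))) := by
  obtain ⟨r0, r1, r2, r3⟩ := bfar_gnoLetter_components true z
  have hs1 : gnoSign true = 1 := by simp [gnoSign]
  rw [hs1] at r0 r1 r2 r3
  set U : ℝ := (z 0) ^ 2 + (z 1) ^ 2 + (z 2) ^ 2 with hU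
  have hU0 : 0 ≤ U := by positivity
  have hnZ : ‖gnoLetter true z‖ ^ 2 = 1 + U := bfar_norm_gnoLetter_sq true z
  have hnZ' : ‖gnoLetter true z‖ = Real.sqrt (1 + U) := by rw [← Real.sqrt_sq (norm_nonneg (gnoLetter true z)), hnZ]
  have hcomp : ‖radialUnit (gnoLetter true z) - 1‖ ^ 2 = (‖gnoLetter true z‖⁻¹ - 1) ^ 2 + (‖gnoLetter true z‖⁻¹) ^ 2 * U := by
    rw [sq_norm_eq_sum_sq, radialUnit_def]
    simp only [Quaternion.re_sub, Quaternion.imI_sub, Quaternion.imJ_sub, Quaternion.imK_sub, Quaternion.re_smul, Quaternion.imI_smul,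
      Quaternion.imJ_smul, Quaternion.imK_smul, smul_eq_mul, r0, r1, r2, r3, Quaternion.re_one, Quaternion.imI_one, Quaternion.imJ_one, Quaternion.imK_one]
    rw [hU]; ring
  rw [hcomp, hnZ', inv_pow, Real.sq_sqrt (by positivity)]
  have h := axial_displacement_core (A := 1) (U := U) one_pos hU0
  rw [Real.sqrt_one, inv_one, one_mul] at h
  calc ((Real.sqrt (1 + U))⁻¹ - 1) ^ 2 + (1 + U)⁻¹ * U = ((Real.sqrt (1 + U))⁻¹ - 1) ^ 2 + U / (1 + U) := by rw [div_eq_inv_mul]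
    _ ≤ 2 * (U / (1 + U)) := h

/-! ## §3 The hub link of the slab hub against the reference hub -/

/-- ★ `‖ν(hubAt δ 1) − ν(hubAt 0 1)‖² ≤ 2·δ²/(1+δ²)`. [folklore] -/
theorem norm_sq_radialUnit_hubAt_sub_le (δ : ℝ) :
    ‖radialUnit (hubAt δ 1) - radialUnit (hubAt 0 1)‖ ^ 2 ≤ 2 * (δ ^ 2 / (1 + δ ^ 2)) := by
  obtain ⟨-, hre, himI, hn2⟩ := bfar_hubAt_facts δ
  obtain ⟨-, hre0, himI0, hn20⟩ := bfar_hubAt_facts (0 : ℝ)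
  have hJ : (hubAt δ 1).imJ = 0 := by simp [hubAt]
  have hK : (hubAt δ 1).imK = 0 := by simp [hubAt]
  have hJ0 : (hubAt (0 : ℝ) 1).imJ = 0 := by simp [hubAt]
  have hK0 : (hubAt (0 : ℝ) 1).imK = 0 := by simp [hubAt]
  have hn : ‖hubAt δ 1‖ = Real.sqrt (1 + δ ^ 2) := by rw [← Real.sqrt_sq (norm_nonneg _), hn2]
  have hn0 : ‖hubAt (0 : ℝ) 1‖ = 1 := by
    have h : ‖hubAt (0 : ℝ) 1‖ ^ 2 = 1 := by rw [hn20]; ring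
    have h0 : 0 ≤ ‖hubAt (0 : ℝ) 1‖ := norm_nonneg _
    nlinarith
  have hcomp : ‖radialUnit (hubAt δ 1) - radialUnit (hubAt 0 1)‖ ^ 2 = (‖hubAt δ 1‖⁻¹) ^ 2 * δ ^ 2 + (‖hubAt δ 1‖⁻¹ - 1) ^ 2 := by
    rw [sq_norm_eq_sum_sq, radialUnit_def, radialUnit_def, hn0]
    simp only [Quaternion.re_sub, Quaternion.imI_sub, Quaternion.imJ_sub, Quaternion.imK_sub, Quaternion.re_smul, Quaternion.imI_smul,
      Quaternion.imJ_smul, Quaternion.imK_smul, smul_eq_mul, hre, himI, hJ, hK, hre0, himI0, hJ0, hK0, inv_one, one_mul]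
    ring
  rw [hcomp, hn, inv_pow, Real.sq_sqrt (by positivity)]
  have h := axial_displacement_core (A := 1) (U := δ ^ 2) one_pos (sq_nonneg δ)
  rw [Real.sqrt_one, inv_one, one_mul] at h
  calc (1 + δ ^ 2)⁻¹ * δ ^ 2 + ((Real.sqrt (1 + δ ^ 2))⁻¹ - 1) ^ 2 = ((Real.sqrt (1 + δ ^ 2))⁻¹ - 1) ^ 2 + δ ^ 2 / (1 + δ ^ 2) := by
        rw [div_eq_inv_mul]; ring
    _ ≤ 2 * (δ ^ 2 / (1 + δ ^ 2)) := h

end Summit.QuantumFields.YangMills.Theorems.SwapVirialDeficit.BlowUpRing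

end
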